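import Mathlib
import Summits.CriticalPhenomena.CardyFormulaZ2.Theorems.CardySelfRefinementDefs
import Summits.CriticalPhenomena.CardyFormulaZ2.Theorems.CardyMagicRigidityLoopsToCrossingsStubZdPlateDuality
import Literature.Probability.Percolation.ThinAnnulusCircuits
import Literature.Probability.Percolation.FourArmGarbanDocking
import Literature.Probability.Percolation.IsoradialProofs
import Literature.Probability.Percolation.SelfRefinementMeasure
import HarnessLib

/-!
# Helper `circuitsAlong` (M1) of stub `stub_fourArmAboveOne`, line `far-field-is-a-quarter-turn`
(crux `TrivialSectorRate`, stmt-CriticalPhenomena-10266): the deterministic half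

Thin-annulus circuits for the dependent model `M_k(γ s)` are glued from four long-way box
crossings exactly as for bond-`ℤ²` (`ThinAnnulusCircuits.lean`, Grimmett 1999 §11.7 (11.78)).
The model `M_k` is only `kℤ²`-translation invariant and is NOT self-dual, so both the recentring
at an arbitrary centre `c` and the closed dual circuits have to be produced at the level of
EVENTS (lattice configurations `ω ⊆ E(ℤ²)`), not of the measure.  This file is that
configuration-wise part:

* `mem_openCircuitInAnnulusAt_of_crossings` — four open long-way crossings of the `c`-translates
  of the boxes `[-b,b] × [a,b]`, `[-b,b] × [-b,-a]`, `[-b,-a] × [-b,b]`, `[a,b] × [-b,b]` give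
  `ω ∈ openCircuitInAnnulusAt c a b` (transport of `mem_openCircuitInAnnulus_of_crossings` along
  the translation by `-c`);
* `dualConfig_mem_tbCrossing_of_not_lrCrossing`, `dualConfig_mem_lrCrossingAt_of_not_tbCrossing` —
  planar duality for translated rectangles in the two orientations: if `ω` has no open
  left-right (resp. top-bottom) crossing of a lattice rectangle, then `dualConfig ω` has an open
  top-bottom (resp. left-right) crossing of the dual rectangle (`lrCrossing_xor_dualTBCrossing_holds`
  transported by translations, `dualConfig_relabel_shift`; the second orientation through double
  duality `dualConfig (dualConfig ω) = ω - (1,1)` — the tree's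
  `OracleSandwich.mem_openCrossing_of_dualConfig_dualConfig` — instead of a transposition);
* `mem_dualCircuitInAnnulusAt_of_not_crossings` — if the four `c`-translated boxes have NO open
  short-way crossings (of the rectangles one unit wider in the short direction), then
  `ω ∈ dualCircuitInAnnulusAt c a b` (registered helper; the probabilistic half is the file
  `…StubFourArmAboveOneCircuits.lean`).

References: G. Grimmett, *Percolation* (1999), §11.2 (planar duality), §11.7 (11.78);
B. Bollobás, O. Riordan, *Percolation* (2006), Ch. 3, Lemma 1.
-/

noncomputable section

namespace Summit.CriticalPhenomena.CardyFormulaZ2.Theorems.CardySelfRefinement.FarField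

open Set MeasureTheory
open Literature.Probability.LatticeModels Literature.Probability.Percolation
open Literature.Probability.Percolation.QuadCrossing
open Summit.CriticalPhenomena.CardyFormulaZ2.Theses.CardySelfRefinement

/-! ### Translations of configurations and of translated regions -/

/-- Shifting a translate: `(· + v) '' ((· + u) '' X) = (· + (u + v)) '' X`. -/
theorem image_shift_image_add (v u : Site 2) (X : Set (Site 2)) :
    (⇑(Site.shift v)) '' ((· + u) '' X) = (· + (u + v)) '' X := by
  rw [Set.image_image]
  congr 1
  funext x
  rw [Site.shift_apply, add_assoc]

/-! ### Open circuits around an arbitrary centre -/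

-- adapted from Literature/Probability/Percolation/ThinAnnulusCircuits.lean
-- (`mem_openCircuitInAnnulus_of_crossings`, recentred by transport along the translation by `-c`)
/-- **Four crossings give an open circuit of `c + A_{a,b}` around `c`** (Grimmett 1999, (11.78),
at arbitrary thickness and centre).  For `1 ≤ a < b` and a lattice configuration `ω`: open
left-right crossings of `c + [-b,b] × [a,b]` and `c + [-b,b] × [-b,-a]` and open top-bottom
crossings of `c + [-b,-a] × [-b,b]` and `c + [a,b] × [-b,b]` give `ω ∈ openCircuitInAnnulusAt c a b`. -/
theorem mem_openCircuitInAnnulusAt_of_crossings {a b : ℕ} (ha : 1 ≤ a) (hab : a < b) (c : Site 2)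
    {ω : BondConfig (Site 2)} (hω : ω ⊆ (zdGraph 2).edgeSet)
    (hT : ω ∈ lrCrossingAt (![-(b : ℤ), (a : ℤ)] + c) (2 * b) (b - a))
    (hB : ω ∈ lrCrossingAt (![-(b : ℤ), -(b : ℤ)] + c) (2 * b) (b - a))
    (hL : ω ∈ openCrossing
      ((· + (![-(b : ℤ), -(b : ℤ)] + c)) '' (rectangle (b - a) (2 * b) : Set (Site 2)))
      ((· + (![-(b : ℤ), -(b : ℤ)] + c)) '' (bottomSide (b - a) (2 * b) : Set (Site 2)))
      ((· + (![-(b : ℤ), -(b : ℤ)] + c)) '' (topSide (b - a) (2 * b) : Set (Site 2))))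
    (hR : ω ∈ openCrossing
      ((· + (![(a : ℤ), -(b : ℤ)] + c)) '' (rectangle (b - a) (2 * b) : Set (Site 2)))
      ((· + (![(a : ℤ), -(b : ℤ)] + c)) '' (bottomSide (b - a) (2 * b) : Set (Site 2)))
      ((· + (![(a : ℤ), -(b : ℤ)] + c)) '' (topSide (b - a) (2 * b) : Set (Site 2)))) :
    ω ∈ openCircuitInAnnulusAt c a b := by
  rw [openCircuitInAnnulusAt_eq_preimage, Set.mem_preimage]
  have hω' : BondConfig.relabel (sym2Equiv (Site.shift (-c))) ω ⊆ (zdGraph 2).edgeSet :=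
    relabel_subset_edgeSet (zdShiftIso (-c)) hω
  have hT' := relabel_mem_openCrossing (Site.shift (-c)) hT
  have hB' := relabel_mem_openCrossing (Site.shift (-c)) hB
  have hL' := relabel_mem_openCrossing (Site.shift (-c)) hL
  have hR' := relabel_mem_openCrossing (Site.shift (-c)) hR
  simp only [image_shift_image_add, add_neg_cancel_right] at hT' hB' hL' hR'
  exact mem_openCircuitInAnnulus_of_crossings ha hab hω' hT' hB' hL' hR'

/-! ### Planar duality for translated rectangles -/

/-- **No open left-right crossing ⟹ a closed dual top-bottom crossing** (translated form of
`lrCrossing_xor_dualTBCrossing_holds`): if the lattice configuration `ω` has no open left-right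
crossing of `v + [0, m+1] × [0, n]`, then `dualConfig ω` has an open top-bottom crossing of the
dual rectangle `(v + (0,-1)) + [0, m] × [0, n+1]` (dual vertices indexed by lower-left corners). -/
theorem dualConfig_mem_tbCrossing_of_not_lrCrossing {ω : BondConfig (Site 2)}
    (hω : ω ⊆ (zdGraph 2).edgeSet) (v : Site 2) (m n : ℕ) (h : ω ∉ lrCrossingAt v (m + 1) n) :
    dualConfig ω ∈ openCrossing ((· + (dualShift + v)) '' (rectangle m (n + 1) : Set (Site 2)))
      ((· + (dualShift + v)) '' (bottomSide m (n + 1) : Set (Site 2)))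
      ((· + (dualShift + v)) '' (topSide m (n + 1) : Set (Site 2))) := by
  have hω₁ : BondConfig.relabel (sym2Equiv (Site.shift (-v))) ω ⊆ (zdGraph 2).edgeSet :=
    relabel_subset_edgeSet (zdShiftIso (-v)) hω
  have hback : ∀ ω' : BondConfig (Site 2), BondConfig.relabel (sym2Equiv (Site.shift v))
      (BondConfig.relabel (sym2Equiv (Site.shift (-v))) ω') = ω' := fun ω' => by
    have e := relabel_shift_neg_relabel_shift (-v) ω'
    rwa [neg_neg] at e
  have h₁ : BondConfig.relabel (sym2Equiv (Site.shift (-v))) ω ∉ lrCrossing (m + 1) n := by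
    intro h1
    apply h
    have h2 := relabel_mem_openCrossing (Site.shift v) h1
    rw [hback] at h2
    exact h2
  -- planar duality at the origin
  have h₂ : BondConfig.relabel (sym2Equiv (Site.shift (-v))) ω ∈ dualTBCrossing (m + 1) n := by
    rcases lrCrossing_xor_dualTBCrossing_holds (m + 1) n hω₁ with h' | h'
    · exact absurd h'.1 h₁
    · exact h'.1
  have h₃ : dualConfig (BondConfig.relabel (sym2Equiv (Site.shift (-v))) ω) ∈
      openCrossing ((· + dualShift) '' (rectangle m (n + 1) : Set (Site 2)))
        ((· + dualShift) '' (bottomSide m (n + 1) : Set (Site 2)))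
        ((· + dualShift) '' (topSide m (n + 1) : Set (Site 2))) := by
    rw [image_dualShift_rectangle, image_dualShift_bottomSide, image_dualShift_topSide,
      openCrossing_comm]
    exact h₂
  rw [dualConfig_relabel_shift] at h₃
  have h₄ := relabel_mem_openCrossing (Site.shift v) h₃
  rw [hback] at h₄
  simpa only [image_shift_image_add] using h₄

/-- The same with the dual rectangle written as `u + [0, m] × [0, n]` (`1 ≤ n`): if `ω` has no
open left-right crossing of `(u + (0,1)) + [0, m+1] × [0, n-1]`, then `dualConfig ω` has an open
top-bottom crossing of `u + [0, m] × [0, n]`. -/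
theorem dualConfig_mem_tbCrossing_of_not_lrCrossing' {ω : BondConfig (Site 2)}
    (hω : ω ⊆ (zdGraph 2).edgeSet) (u : Site 2) (m : ℕ) {n : ℕ} (hn : 1 ≤ n)
    (h : ω ∉ lrCrossingAt (![(0 : ℤ), 1] + u) (m + 1) (n - 1)) :
    dualConfig ω ∈ openCrossing ((· + u) '' (rectangle m n : Set (Site 2)))
      ((· + u) '' (bottomSide m n : Set (Site 2))) ((· + u) '' (topSide m n : Set (Site 2))) := by
  obtain ⟨n', rfl⟩ : ∃ n', n = n' + 1 := ⟨n - 1, by omega⟩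
  have hu : dualShift + (![(0 : ℤ), 1] + u) = u := by
    ext i
    fin_cases i <;> simp [dualShift, Matrix.vecHead, Matrix.vecTail]
  have h' : ω ∉ lrCrossingAt (![(0 : ℤ), 1] + u) (m + 1) n' := by simpa using h
  have key := dualConfig_mem_tbCrossing_of_not_lrCrossing hω (![(0 : ℤ), 1] + u) m n' h'
  rwa [hu] at key

/-! ### Double duality: the transposed orientation -/

/-- The diagonal shift matching the two indexings: `(· + (1,1))⁻¹ (X + (1,0)) = X + (0,-1)`. -/
theorem preimage_add_one_image_add (X : Set (Site 2)) :
    (· + (1 : Site 2)) ⁻¹' ((· + ![(1 : ℤ), 0]) '' X) = (· + dualShift) '' X := by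
  have key : ∀ z : Site 2, z + 1 + -![(1 : ℤ), 0] = z + -dualShift := by
    intro z
    ext i
    fin_cases i <;> simp [dualShift]
  ext z
  simp only [Set.image_add_right, Set.mem_preimage, key]

/-- **No open top-bottom crossing ⟹ a closed dual left-right crossing** (transposed planar
duality at the origin, by double duality): if the lattice configuration `ω` has no open
top-bottom crossing of `(1,0) + [0, m] × [0, n+1]`, then `dualConfig ω ∈ LR([0, m+1] × [0, n])`. -/
theorem dualConfig_mem_lrCrossing_of_not_tbCrossing {ω : BondConfig (Site 2)}
    (hω : ω ⊆ (zdGraph 2).edgeSet) (m n : ℕ)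
    (h : ω ∉ openCrossing ((· + ![(1 : ℤ), 0]) '' (rectangle m (n + 1) : Set (Site 2)))
      ((· + ![(1 : ℤ), 0]) '' (bottomSide m (n + 1) : Set (Site 2)))
      ((· + ![(1 : ℤ), 0]) '' (topSide m (n + 1) : Set (Site 2)))) :
    dualConfig ω ∈ lrCrossing (m + 1) n := by
  have hωd : dualConfig ω ⊆ (zdGraph 2).edgeSet := fun _ he => (mem_dualConfig_iff.1 he).1
  rcases lrCrossing_xor_dualTBCrossing_holds (m + 1) n hωd with h' | h'
  · exact h'.1
  · exfalso
    apply h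
    have h₂ : dualConfig (dualConfig ω) ∈ openCrossing (↑(dualRectangle (m + 1) n) : Set (Site 2))
        ↑(dualTopSide (m + 1) n) ↑(dualBottomSide (m + 1) n) := h'.1
    rw [← image_dualShift_rectangle, ← image_dualShift_topSide, ← image_dualShift_bottomSide,
      openCrossing_comm, ← preimage_add_one_image_add, ← preimage_add_one_image_add,
      ← preimage_add_one_image_add] at h₂
    exact Summit.CriticalPhenomena.CardyFormulaZ2.Cruxes.LoopsToCrossings.OracleSandwich.mem_openCrossing_of_dualConfig_dualConfig
      hω h₂

/-- Translated form with the dual rectangle written as `u + [0, m] × [0, n]` (`1 ≤ m`): if `ω` has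
no open top-bottom crossing of `(u + (1,0)) + [0, m-1] × [0, n+1]`, then `dualConfig ω` has an
open left-right crossing of `u + [0, m] × [0, n]`. -/
theorem dualConfig_mem_lrCrossingAt_of_not_tbCrossing {ω : BondConfig (Site 2)}
    (hω : ω ⊆ (zdGraph 2).edgeSet) (u : Site 2) {m : ℕ} (hm : 1 ≤ m) (n : ℕ)
    (h : ω ∉ openCrossing ((· + (![(1 : ℤ), 0] + u)) '' (rectangle (m - 1) (n + 1) : Set (Site 2)))
      ((· + (![(1 : ℤ), 0] + u)) '' (bottomSide (m - 1) (n + 1) : Set (Site 2)))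
      ((· + (![(1 : ℤ), 0] + u)) '' (topSide (m - 1) (n + 1) : Set (Site 2)))) :
    dualConfig ω ∈ lrCrossingAt u m n := by
  obtain ⟨m', rfl⟩ : ∃ m', m = m' + 1 := ⟨m - 1, by omega⟩
  rw [Nat.add_sub_cancel] at h
  have hω₁ : BondConfig.relabel (sym2Equiv (Site.shift (-u))) ω ⊆ (zdGraph 2).edgeSet :=
    relabel_subset_edgeSet (zdShiftIso (-u)) hω
  have hback : ∀ ω' : BondConfig (Site 2), BondConfig.relabel (sym2Equiv (Site.shift u))
      (BondConfig.relabel (sym2Equiv (Site.shift (-u))) ω') = ω' := fun ω' => by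
    have e := relabel_shift_neg_relabel_shift (-u) ω'
    rwa [neg_neg] at e
  have h₁ : BondConfig.relabel (sym2Equiv (Site.shift (-u))) ω ∉
      openCrossing ((· + ![(1 : ℤ), 0]) '' (rectangle m' (n + 1) : Set (Site 2)))
        ((· + ![(1 : ℤ), 0]) '' (bottomSide m' (n + 1) : Set (Site 2)))
        ((· + ![(1 : ℤ), 0]) '' (topSide m' (n + 1) : Set (Site 2))) := by
    intro h1
    apply h
    have h2 := relabel_mem_openCrossing (Site.shift u) h1
    rw [hback] at h2
    simpa only [image_shift_image_add] using h2
  have h₂ := dualConfig_mem_lrCrossing_of_not_tbCrossing hω₁ m' n h₁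
  rw [dualConfig_relabel_shift] at h₂
  have h₃ := relabel_mem_openCrossing (Site.shift u) h₂
  rw [hback] at h₃
  exact h₃

/-! ### Closed dual circuits around an arbitrary centre -/

/-- **Four missing short-way crossings give a closed dual circuit of `c + A*_{a,b}`** (registered
helper of `circuitsAlong`).  For `1 ≤ a < b` and a lattice configuration `ω`: if `ω` has no open
top-bottom crossing of `c + [1-b, b] × [a, b+1]` and of `c + [1-b, b] × [-b, 1-a]`, and no open
left-right crossing of `c + [-b, 1-a] × [1-b, b]` and of `c + [a, b+1] × [1-b, b]`, then by planar
duality `dualConfig ω` crosses the four boxes of `mem_openCircuitInAnnulusAt_of_crossings` the long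
way, hence `ω ∈ dualCircuitInAnnulusAt c a b`. -/
theorem mem_dualCircuitInAnnulusAt_of_not_crossings {a b : ℕ} (ha : 1 ≤ a) (hab : a < b)
    (c : Site 2) {ω : BondConfig (Site 2)} (hω : ω ⊆ (zdGraph 2).edgeSet)
    (hT : ω ∉ openCrossing
      ((· + (![(1 : ℤ), 0] + (![-(b : ℤ), (a : ℤ)] + c))) '' (rectangle (2 * b - 1) (b - a + 1) : Set (Site 2)))
      ((· + (![(1 : ℤ), 0] + (![-(b : ℤ), (a : ℤ)] + c))) '' (bottomSide (2 * b - 1) (b - a + 1) : Set (Site 2)))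
      ((· + (![(1 : ℤ), 0] + (![-(b : ℤ), (a : ℤ)] + c))) '' (topSide (2 * b - 1) (b - a + 1) : Set (Site 2))))
    (hB : ω ∉ openCrossing
      ((· + (![(1 : ℤ), 0] + (![-(b : ℤ), -(b : ℤ)] + c))) '' (rectangle (2 * b - 1) (b - a + 1) : Set (Site 2)))
      ((· + (![(1 : ℤ), 0] + (![-(b : ℤ), -(b : ℤ)] + c))) '' (bottomSide (2 * b - 1) (b - a + 1) : Set (Site 2)))
      ((· + (![(1 : ℤ), 0] + (![-(b : ℤ), -(b : ℤ)] + c))) '' (topSide (2 * b - 1) (b - a + 1) : Set (Site 2))))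
    (hL : ω ∉ lrCrossingAt (![(0 : ℤ), 1] + (![-(b : ℤ), -(b : ℤ)] + c)) (b - a + 1) (2 * b - 1))
    (hR : ω ∉ lrCrossingAt (![(0 : ℤ), 1] + (![(a : ℤ), -(b : ℤ)] + c)) (b - a + 1) (2 * b - 1)) :
    ω ∈ dualCircuitInAnnulusAt c a b := by
  have h2b : 1 ≤ 2 * b := by omega
  show dualConfig ω ∈ openCircuitInAnnulusAt c a b
  have hωd : dualConfig ω ⊆ (zdGraph 2).edgeSet := fun _ he => (mem_dualConfig_iff.1 he).1
  refine mem_openCircuitInAnnulusAt_of_crossings ha hab c hωd ?_ ?_ ?_ ?_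
  · exact dualConfig_mem_lrCrossingAt_of_not_tbCrossing hω _ h2b (b - a) hT
  · exact dualConfig_mem_lrCrossingAt_of_not_tbCrossing hω _ h2b (b - a) hB
  · exact dualConfig_mem_tbCrossing_of_not_lrCrossing' hω _ (b - a) h2b hL
  · exact dualConfig_mem_tbCrossing_of_not_lrCrossing' hω _ (b - a) h2b hR

end Summit.CriticalPhenomena.CardyFormulaZ2.Theorems.CardySelfRefinement.FarField

end
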